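import Literature.Topology.FourManifolds.ZeroSphereSurgeryModelGluing
import Literature.Topology.FourManifolds.ImmersionCriterion
import Literature.Topology.FourManifolds.EquidimensionalEmbedding
import Literature.Topology.FourManifolds.MonotoneInverse
import HarnessLib

/-!
# The local model of the `0`-surgery along a framed `S⁰`, III: the blow-up of the chart ball
# and the two standard framing discs

Topic `Literature/Topology/FourManifolds`.  Third file of the proof of *"`0`-surgery along an
orientably framed `S⁰` in a connected `3`-manifold `Z` gives `Z # (S² × S¹)"* (A. Kosinski,
*Differential Manifolds* (1993), VI §9 with VI (3.1), (6.6); J. Milnor, *Lectures on the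
h-cobordism theorem* (1965), Def. 3.11, Thm. 3.13), proving the properties of the definitions of
`ZeroSphereSurgeryModelGluing.lean`, §§8–9:

* §A the blow-up profile `blowProfile` (smooth on `(-∞, 1/8)`, derivative `≥ 8`, strictly
  increasing, onto `[0, ∞)` from `[0, 1/8)`) and its inverse `blowProfileInv` (explicit on the
  linear zone `[0, 1/4]` and on the Möbius zone `[4/7, ∞)`, smooth on `(0, ∞)` by the inverse
  function theorem — the tree's `contDiffAt_of_eventually_leftInverse`);
* §B the blow-up `blowUp : B(0, 1/8) → ℝ³` and the blow-down `blowDown : ℝ³ → B(0, 1/8)`: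
  mutually inverse, smooth, `8 • id` / `8⁻¹ • id` near the origin;
* §C the compression `fourBall` (`= id` on the closed unit ball, range `B(0, 4)`);
* §D the Möbius map `farMob = N ∘ inv₈` (closed form, smooth on `B(0, 16/3)`, injective on
  `B(0, 4)`, range in `B(0, 2)`, derivative `8⁻¹ • id` at `0`);
* §E a smooth-embedding criterion for injective étale maps `ℝ³ → ℝ³`
  (`isSmoothEmbedding_of_injective_of_injective_fderiv`, from the tree's
  `isImmersion_of_injective_mfderiv` and the equidimensional local-diffeomorphism lemma), and the
  two standard discs `discNear`, `discFar : ℝ³ → ℝ³`: smooth embeddings with open, disjoint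
  ranges inside the ball of radius `1/12` of the chart, centres `nearCentre = β̂⁻¹ (N 0)` and `0`,
  and their closed-unit-ball values `β̂⁻¹ (N (x/4))`, `β̂⁻¹ (farMob x)`.

Everything here is proved; no definitions and no named facts are introduced.

## References

* A. A. Kosinski, *Differential Manifolds*, Academic Press (1993), VI §9. [Kosinski1993]
* J. M. Lee, *Introduction to Smooth Manifolds*, 2nd ed. (2013), Prop. 4.22, 5.2. [LeeSmoothManifolds2013]
-/

open scoped Manifold ContDiff Topology
open Set Function Metric

noncomputable section

namespace Literature.Topology.FourManifolds

namespace ZeroSphereModel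

/-! ### §A The blow-up profile -/

/-- `χ̂` is smooth. [folklore] -/
theorem contDiff_blowCut {n : ℕ∞} : ContDiff ℝ n blowCut :=
  Real.smoothTransition.contDiff.comp ((contDiff_const.mul contDiff_id).sub contDiff_const |>.div_const _)

/-- `χ̂` is monotone. [folklore] -/
theorem blowCut_monotone : Monotone blowCut := fun a b hab =>
  Real.smoothTransition.monotone (by
    show (352 * a - 11) / 5 ≤ (352 * b - 11) / 5
    apply div_le_div_of_nonneg_right _ (by norm_num); linarith)

/-- `0 ≤ χ̂`. [folklore] -/
theorem blowCut_nonneg (s : ℝ) : 0 ≤ blowCut s := Real.smoothTransition.nonneg _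

/-- `χ̂ ≤ 1`. [folklore] -/
theorem blowCut_le_one (s : ℝ) : blowCut s ≤ 1 := Real.smoothTransition.le_one _

/-- `χ̂` is differentiable. [folklore] -/
theorem differentiable_blowCut : Differentiable ℝ blowCut :=
  (contDiff_blowCut (n := 1)).differentiable one_ne_zero

/-- `χ̂' ≥ 0`. [folklore] -/
theorem deriv_blowCut_nonneg (s : ℝ) : 0 ≤ deriv blowCut s :=
  (differentiable_blowCut s).hasDerivAt.nonneg_of_monotone blowCut_monotone

/-- `b̂ 0 = 0`. [folklore] -/
theorem blowProfile_zero : blowProfile 0 = 0 := by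
  rw [blowProfile_of_le (by norm_num)]; ring

/-- `b̂ (1/22) = 4/7`. [folklore] -/
theorem blowProfile_one_div : blowProfile (1 / 22) = 4 / 7 := by
  rw [blowProfile_of_ge le_rfl (by norm_num)]; norm_num

/-- `b̂` is smooth on `(-∞, 1/8)`. [folklore] -/
theorem contDiffAt_blowProfile {s : ℝ} (h : s < 1 / 8) : ContDiffAt ℝ ∞ blowProfile s := by
  have hne : 1 - 8 * s ≠ 0 := by intro h0; linarith
  have hD : ContDiffAt ℝ ∞ (fun s : ℝ => 64 * s ^ 2 / (1 - 8 * s)) s :=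
    (contDiffAt_const.mul (contDiffAt_id.pow 2)).div (contDiffAt_const.sub (contDiffAt_const.mul contDiffAt_id)) hne
  show ContDiffAt ℝ ∞ (fun s : ℝ => 8 * s + blowCut s * (64 * s ^ 2 / (1 - 8 * s))) s
  exact (contDiffAt_const.mul contDiffAt_id).add ((contDiff_blowCut (n := ⊤)).contDiffAt.mul hD)

/-- The derivative of `b̂` at `s < 1/8`. [folklore] -/
theorem hasDerivAt_blowProfile {s : ℝ} (h : s < 1 / 8) :
    HasDerivAt blowProfile (8 + (deriv blowCut s * (64 * s ^ 2 / (1 - 8 * s)) +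
      blowCut s * ((128 * s * (1 - 8 * s) + 512 * s ^ 2) / (1 - 8 * s) ^ 2))) s := by
  have hne : 1 - 8 * s ≠ 0 := by intro h0; linarith
  have hχ : HasDerivAt blowCut (deriv blowCut s) s := (differentiable_blowCut s).hasDerivAt
  have hD : HasDerivAt (fun s : ℝ => 64 * s ^ 2 / (1 - 8 * s))
      ((128 * s * (1 - 8 * s) + 512 * s ^ 2) / (1 - 8 * s) ^ 2) s := by
    have h1 : HasDerivAt (fun s : ℝ => 64 * s ^ 2) (128 * s) s := by
      simpa using ((hasDerivAt_id' s).pow 2).const_mul 64 |>.congr_deriv (by ring)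
    have h2 : HasDerivAt (fun s : ℝ => 1 - 8 * s) (-8) s := by
      simpa using ((hasDerivAt_id' s).const_mul 8).const_sub 1
    refine (h1.div h2 hne).congr_deriv ?_
    ring
  have h0 : HasDerivAt (fun s : ℝ => 8 * s) 8 s := by simpa using (hasDerivAt_id' s).const_mul 8
  exact h0.add (hχ.mul hD)

/-- The derivative of `b̂` is at least `8` on `(-∞, 1/8)`. [folklore] -/
theorem deriv_blowProfile_ge {s : ℝ} (h : s < 1 / 8) : 8 ≤ deriv blowProfile s := by
  rw [(hasDerivAt_blowProfile h).deriv]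
  have hχ0 := blowCut_nonneg s
  have hχ' := deriv_blowCut_nonneg s
  have hs8 : 0 < 1 - 8 * s := by linarith
  have hD : 0 ≤ 64 * s ^ 2 / (1 - 8 * s) := div_nonneg (by positivity) hs8.le
  have hkey : 0 ≤ blowCut s * ((128 * s * (1 - 8 * s) + 512 * s ^ 2) / (1 - 8 * s) ^ 2) := by
    rcases le_or_gt s (1 / 32) with h32 | h32
    · rw [blowCut_of_le h32, zero_mul]
    · refine mul_nonneg hχ0 (div_nonneg ?_ (by positivity))
      nlinarith
  nlinarith [mul_nonneg hχ' hD]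

/-- `b̂` is continuous on `(-∞, 1/8)`. [folklore] -/
theorem continuousOn_blowProfile : ContinuousOn blowProfile (Iio (1 / 8)) := fun _ hs =>
  (contDiffAt_blowProfile hs).continuousAt.continuousWithinAt

/-- `b̂` is strictly increasing on `(-∞, 1/8)`. [folklore] -/
theorem strictMonoOn_blowProfile : StrictMonoOn blowProfile (Iio (1 / 8)) :=
  strictMonoOn_of_deriv_pos (convex_Iio _) continuousOn_blowProfile fun x hx => by
    rw [interior_Iio] at hx
    linarith [deriv_blowProfile_ge hx]

/-- `b̂` is injective on `[0, 1/8)`. [folklore] -/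
theorem injOn_blowProfile : InjOn blowProfile (Ico 0 (1 / 8)) :=
  (strictMonoOn_blowProfile.mono fun _ hx => hx.2).injOn

/-- `b̂ ≥ 0` on `[0, 1/8)`. [folklore] -/
theorem blowProfile_nonneg {s : ℝ} (h0 : 0 ≤ s) (h : s < 1 / 8) : 0 ≤ blowProfile s := by
  rw [← blowProfile_zero]
  exact (strictMonoOn_blowProfile.mono fun _ hx => hx).monotoneOn (by norm_num : (0 : ℝ) < 1 / 8) h h0

/-- `b̂` maps `[0, 1/8)` onto `[0, ∞)`. [folklore] -/
theorem exists_blowProfile_eq {r : ℝ} (hr : 0 ≤ r) : ∃ s, s ∈ Ico (0 : ℝ) (1 / 8) ∧ blowProfile s = r := by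
  rcases le_or_gt (4 / 7) r with h1 | h1
  · -- explicit preimage `r/(8 (1 + r))` in the Möbius zone
    have h1r : 0 < 1 + r := by linarith
    refine ⟨r / (8 * (1 + r)), ⟨by positivity, ?_⟩, ?_⟩
    · rw [div_lt_div_iff₀ (by positivity) (by norm_num)]; nlinarith
    · rw [blowProfile_of_ge]
      · field_simp
        ring
      · rw [le_div_iff₀ (by positivity)]; nlinarith
      · intro h; field_simp at h; nlinarith
  · have hc : ContinuousOn blowProfile (Icc 0 (1 / 22)) :=
      continuousOn_blowProfile.mono fun x hx => lt_of_le_of_lt hx.2 (by norm_num)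
    have hmem : r ∈ Icc (blowProfile 0) (blowProfile (1 / 22)) := by
      rw [blowProfile_zero, blowProfile_one_div]; exact ⟨hr, h1.le⟩
    obtain ⟨s, hs, hsr⟩ := intermediate_value_Icc (by norm_num : (0 : ℝ) ≤ 1 / 22) hc hmem
    exact ⟨s, ⟨hs.1, lt_of_le_of_lt hs.2 (by norm_num)⟩, hsr⟩

/-- `b̂⁻¹ r ∈ [0, 1/8)` and `b̂ (b̂⁻¹ r) = r` for `r ≥ 0`. [folklore] -/
theorem blowProfileInv_spec {r : ℝ} (hr : 0 ≤ r) :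
    blowProfileInv r ∈ Ico (0 : ℝ) (1 / 8) ∧ blowProfile (blowProfileInv r) = r := by
  obtain ⟨s, hs, hsr⟩ := exists_blowProfile_eq hr
  have h : ∃ s ∈ Ico (0 : ℝ) (1 / 8), blowProfile s = r := ⟨s, hs, hsr⟩
  exact ⟨invFunOn_mem h, invFunOn_eq h⟩

/-- `b̂⁻¹ (b̂ s) = s` for `s ∈ [0, 1/8)`. [folklore] -/
theorem blowProfileInv_blowProfile {s : ℝ} (hs : s ∈ Ico (0 : ℝ) (1 / 8)) : blowProfileInv (blowProfile s) = s :=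
  injOn_blowProfile.leftInvOn_invFunOn hs

/-- `b̂⁻¹ r = r/8` for `0 ≤ r ≤ 1/4` (the linear zone). [folklore] -/
theorem blowProfileInv_of_le {r : ℝ} (h0 : 0 ≤ r) (h : r ≤ 1 / 4) : blowProfileInv r = r / 8 := by
  have h1 : blowProfile (r / 8) = r := by rw [blowProfile_of_le (by linarith)]; ring
  rw [← h1, blowProfileInv_blowProfile ⟨by positivity, by linarith⟩, h1]

/-- `b̂⁻¹ r = r/(8 (1 + r))` for `r ≥ 4/7` (the Möbius zone). [folklore] -/
theorem blowProfileInv_of_ge {r : ℝ} (h : 4 / 7 ≤ r) : blowProfileInv r = r / (8 * (1 + r)) := by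
  have h1r : 0 < 1 + r := by linarith
  have hs : r / (8 * (1 + r)) ∈ Ico (0 : ℝ) (1 / 8) := by
    refine ⟨by positivity, ?_⟩
    rw [div_lt_div_iff₀ (by positivity) (by norm_num)]; nlinarith
  have h1 : blowProfile (r / (8 * (1 + r))) = r := by
    rw [blowProfile_of_ge]
    · field_simp; ring
    · rw [le_div_iff₀ (by positivity)]; nlinarith
    · exact ne_of_lt hs.2
  rw [← h1, blowProfileInv_blowProfile hs, h1]

/-- `b̂⁻¹ 0 = 0`. [folklore] -/
theorem blowProfileInv_zero : blowProfileInv 0 = 0 := by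
  rw [blowProfileInv_of_le le_rfl (by norm_num)]; ring

/-- `b̂⁻¹ r > 0` for `r > 0`. [folklore] -/
theorem blowProfileInv_pos {r : ℝ} (hr : 0 < r) : 0 < blowProfileInv r := by
  obtain ⟨hmem, heq⟩ := blowProfileInv_spec hr.le
  rcases hmem.1.lt_or_eq with h | h
  · exact h
  · rw [← h, blowProfile_zero] at heq; linarith

/-- `b̂⁻¹` is smooth at every `r > 0`. [folklore] -/
theorem contDiffAt_blowProfileInv {r : ℝ} (hr : 0 < r) : ContDiffAt ℝ ∞ blowProfileInv r := by
  obtain ⟨hmem, heq⟩ := blowProfileInv_spec hr.le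
  set a := blowProfileInv r with ha
  have ha0 : 0 < a := blowProfileInv_pos hr
  have hlt : a < 1 / 8 := hmem.2
  rw [← heq]
  refine contDiffAt_of_eventually_leftInverse (contDiffAt_blowProfile hlt) (hasDerivAt_blowProfile hlt)
    (by linarith [deriv_blowProfile_ge hlt, (hasDerivAt_blowProfile hlt).deriv]) (by simp) ?_
  filter_upwards [Ioo_mem_nhds ha0 hlt] with x hx
  exact blowProfileInv_blowProfile ⟨hx.1.le, hx.2⟩

/-! ### §B The blow-up and the blow-down -/

/-- `β̂ = 8 • id` on the ball of radius `1/32`. [folklore] -/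
theorem blowUp_eq_smul_of_norm_lt {y : EuclideanSpace ℝ (Fin 3)} (hy : ‖y‖ < 1 / 32) : blowUp y = (8 : ℝ) • y :=
  radialMap_eq_smul_of_norm_lt blowProfile (fun _ _ ht => blowProfile_of_le ht.le) hy

/-- `β̂⁻¹ = 8⁻¹ • id` on the ball of radius `1/4`. [folklore] -/
theorem blowDown_eq_smul_of_norm_lt {z : EuclideanSpace ℝ (Fin 3)} (hz : ‖z‖ < 1 / 4) :
    blowDown z = (8 : ℝ)⁻¹ • z :=
  radialMap_eq_smul_of_norm_lt blowProfileInv (fun t ht0 ht => by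
    rw [blowProfileInv_of_le ht0.le ht.le]; ring) hz

/-- `β̂ 0 = 0`. [folklore] -/
@[simp] theorem blowUp_zero : blowUp 0 = 0 := radialMap_zero _

/-- `β̂⁻¹ 0 = 0`. [folklore] -/
@[simp] theorem blowDown_zero : blowDown 0 = 0 := radialMap_zero _

/-- `‖β̂ y‖ = b̂ ‖y‖` on the ball of radius `1/8`. [folklore] -/
theorem norm_blowUp {y : EuclideanSpace ℝ (Fin 3)} (hy : ‖y‖ < 1 / 8) : ‖blowUp y‖ = blowProfile ‖y‖ := by
  rcases eq_or_ne y 0 with rfl | hy0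
  · simp [blowProfile_zero]
  · rw [blowUp, norm_radialMap _ hy0, abs_of_nonneg (blowProfile_nonneg (norm_nonneg _) hy)]

/-- `‖β̂⁻¹ z‖ = b̂⁻¹ ‖z‖`. [folklore] -/
theorem norm_blowDown (z : EuclideanSpace ℝ (Fin 3)) : ‖blowDown z‖ = blowProfileInv ‖z‖ := by
  rcases eq_or_ne z 0 with rfl | hz0
  · simp [blowProfileInv_zero]
  · rw [blowDown, norm_radialMap _ hz0, abs_of_nonneg (blowProfileInv_spec (norm_nonneg _)).1.1]

/-- `‖β̂⁻¹ z‖ < 1/8`: the blow-down lands in the chart ball. [folklore] -/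
theorem norm_blowDown_lt (z : EuclideanSpace ℝ (Fin 3)) : ‖blowDown z‖ < 1 / 8 := by
  rw [norm_blowDown]; exact (blowProfileInv_spec (norm_nonneg _)).1.2

/-- `β̂⁻¹ (β̂ y) = y` on the ball of radius `1/8`. [folklore] -/
theorem blowDown_blowUp {y : EuclideanSpace ℝ (Fin 3)} (hy : ‖y‖ < 1 / 8) : blowDown (blowUp y) = y := by
  rcases eq_or_ne y 0 with rfl | hy0
  · simp
  · have hpos : 0 < blowProfile ‖y‖ := by
      have := strictMonoOn_blowProfile (show (0:ℝ) ∈ Iio (1/8) by norm_num) hy (norm_pos_iff.2 hy0)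
      rwa [blowProfile_zero] at this
    rw [blowDown, blowUp, radialMap_radialMap _ _ hy0 hpos, blowProfileInv_blowProfile ⟨norm_nonneg _, hy⟩,
      mul_inv_cancel₀ (norm_ne_zero_iff.2 hy0), one_smul]

/-- `β̂ (β̂⁻¹ z) = z`. [folklore] -/
theorem blowUp_blowDown (z : EuclideanSpace ℝ (Fin 3)) : blowUp (blowDown z) = z := by
  rcases eq_or_ne z 0 with rfl | hz0
  · simp
  · have hpos : 0 < blowProfileInv ‖z‖ := blowProfileInv_pos (norm_pos_iff.2 hz0)
    rw [blowDown, blowUp, radialMap_radialMap _ _ hz0 hpos, (blowProfileInv_spec (norm_nonneg z)).2,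
      mul_inv_cancel₀ (norm_ne_zero_iff.2 hz0), one_smul]

/-- `β̂⁻¹` is injective. [folklore] -/
theorem blowDown_injective : Injective blowDown := fun z z' h => by
  rw [← blowUp_blowDown z, h, blowUp_blowDown]

/-- `β̂` is injective on the ball of radius `1/8`. [folklore] -/
theorem blowUp_injOn : InjOn blowUp (ball 0 (1 / 8)) := fun y hy y' hy' h => by
  rw [mem_ball_zero_iff] at hy hy'
  rw [← blowDown_blowUp hy, h, blowDown_blowUp hy']

/-- `β̂ y = 0` only for `y = 0` (on the chart ball). [folklore] -/
theorem blowUp_ne_zero {y : EuclideanSpace ℝ (Fin 3)} (hy : ‖y‖ < 1 / 8) (hy0 : y ≠ 0) : blowUp y ≠ 0 := fun h =>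
  hy0 (blowUp_injOn (mem_ball_zero_iff.2 hy) (mem_ball_zero_iff.2 (by norm_num)) (h.trans blowUp_zero.symm))

/-- `β̂⁻¹ z = 0` only for `z = 0`. [folklore] -/
theorem blowDown_ne_zero {z : EuclideanSpace ℝ (Fin 3)} (hz : z ≠ 0) : blowDown z ≠ 0 := fun h =>
  hz (blowDown_injective (h.trans blowDown_zero.symm))

/-- `β̂` is smooth on the ball of radius `1/8`. [folklore] -/
theorem contDiffAt_blowUp {y : EuclideanSpace ℝ (Fin 3)} (hy : ‖y‖ < 1 / 8) : ContDiffAt ℝ ∞ blowUp y := by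
  rcases eq_or_ne y 0 with rfl | hy0
  · have hev : blowUp =ᶠ[𝓝 (0 : EuclideanSpace ℝ (Fin 3))] fun y => (8 : ℝ) • y :=
      Filter.eventuallyEq_of_mem (ball_mem_nhds _ (by norm_num : (0:ℝ) < 1 / 32)) fun y hy =>
        blowUp_eq_smul_of_norm_lt (mem_ball_zero_iff.1 hy)
    exact (contDiff_const_smul (8 : ℝ)).contDiffAt.congr_of_eventuallyEq hev
  · exact contDiffAt_radialMap hy0 (contDiffAt_blowProfile hy)

/-- `β̂⁻¹` is smooth. [folklore] -/
theorem contDiff_blowDown : ContDiff ℝ ∞ blowDown := by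
  rw [contDiff_iff_contDiffAt]
  intro z
  rcases eq_or_ne z 0 with rfl | hz0
  · have hev : blowDown =ᶠ[𝓝 (0 : EuclideanSpace ℝ (Fin 3))] fun z => (8 : ℝ)⁻¹ • z :=
      Filter.eventuallyEq_of_mem (ball_mem_nhds _ (by norm_num : (0:ℝ) < 1 / 4)) fun z hz =>
        blowDown_eq_smul_of_norm_lt (mem_ball_zero_iff.1 hz)
    exact (contDiff_const_smul (8 : ℝ)⁻¹).contDiffAt.congr_of_eventuallyEq hev
  · exact contDiffAt_radialMap hz0 (contDiffAt_blowProfileInv (norm_pos_iff.2 hz0))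

/-- The blow-up of the shell `1/22 ≤ ‖y‖ < 1/8` in closed form: `β̂ y = (8/(1 - 8‖y‖)) • y`.
[folklore] -/
theorem blowUp_of_ge {y : EuclideanSpace ℝ (Fin 3)} (h : 1 / 22 ≤ ‖y‖) (hy : ‖y‖ < 1 / 8) :
    blowUp y = (8 / (1 - 8 * ‖y‖)) • y := by
  have hy0 : y ≠ 0 := by rw [← norm_pos_iff]; linarith
  rw [blowUp, radialMap, blowProfile_of_ge h hy.ne]
  congr 1
  have : ‖y‖ ≠ 0 := norm_ne_zero_iff.2 hy0
  field_simp

/-- The blow-up radius of the Möbius zone: `‖β̂ y‖ ≥ 4/7` iff `‖y‖ ≥ 1/22` (on the chart ball).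
[folklore] -/
theorem le_norm_blowUp_iff {y : EuclideanSpace ℝ (Fin 3)} (hy : ‖y‖ < 1 / 8) : 4 / 7 ≤ ‖blowUp y‖ ↔ 1 / 22 ≤ ‖y‖ := by
  rw [norm_blowUp hy, ← blowProfile_one_div]
  exact (strictMonoOn_blowProfile.le_iff_le (by norm_num) hy)

/-! ### §C The compression `fourBall` -/

/-- `fourBall x = x` on the closed unit ball. [folklore] -/
theorem fourBall_eq_self {x : EuclideanSpace ℝ (Fin 3)} (hx : ‖x‖ ≤ 1) : fourBall x = x := by
  rcases eq_or_ne x 0 with rfl | hx0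
  · simp [fourBall, ballContraction_zero]
  · have hxn : 0 < ‖x‖ := norm_pos_iff.2 hx0
    set u : EuclideanSpace ℝ (Fin 3) := ‖x‖⁻¹ • x with hu
    have hun : ‖u‖ = 1 := by rw [hu, norm_smul, norm_inv, norm_norm, inv_mul_cancel₀ hxn.ne']
    have hxu : x = ‖x‖ • u := by rw [hu, smul_smul, mul_inv_cancel₀ hxn.ne', one_smul]
    rw [fourBall, hxu, smul_smul, ballContraction_smul hun (by positivity), ballProfile_of_le (by linarith),
      smul_smul]
    congr 1
    ring

/-- `‖fourBall x‖ < 4`. [folklore] -/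
theorem norm_fourBall_lt (x : EuclideanSpace ℝ (Fin 3)) : ‖fourBall x‖ < 4 := by
  rw [fourBall, norm_smul, Real.norm_of_nonneg (by norm_num : (0:ℝ) ≤ 4)]
  linarith [norm_ballContraction_lt_one ((8 : ℝ) • x)]

/-- `fourBall` is smooth. [folklore] -/
theorem contDiff_fourBall : ContDiff ℝ ∞ fourBall := by
  have h : ContDiff ℝ ∞ fun x : EuclideanSpace ℝ (Fin 3) => (8 : ℝ) • x := contDiff_const_smul _
  exact (contDiff_ballContraction.comp h).const_smul (4 : ℝ)

/-- `fourBall` is injective. [folklore] -/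
theorem fourBall_injective : Injective fourBall := fun x x' h => by
  have h1 : ballContraction ((8 : ℝ) • x) = ballContraction ((8 : ℝ) • x') :=
    smul_right_injective _ (by norm_num : (4 : ℝ) ≠ 0) h
  exact smul_right_injective _ (by norm_num : (8 : ℝ) ≠ 0) (injective_ballContraction h1)

/-- `fourBall x = 0` iff `x = 0`. [folklore] -/
theorem fourBall_eq_zero_iff {x : EuclideanSpace ℝ (Fin 3)} : fourBall x = 0 ↔ x = 0 := by
  constructor
  · intro h
    apply fourBall_injective
    rw [h, fourBall_eq_self (by simp)]
  · rintro rfl; exact fourBall_eq_self (by simp)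

/-! ### §D The Möbius map `N ∘ inv₈` in closed form -/

/-- The denominator `64 - 16 ⟪w, q⟫ + ‖q‖² ‖w‖²` of `farMob` is positive on `B(0, 16/3)`
(Cauchy–Schwarz: it is at least `(8 - 3‖w‖/2)²`). [folklore] -/
theorem farDen_pos {w : EuclideanSpace ℝ (Fin 3)} (hw : ‖w‖ < 16 / 3) :
    0 < 64 - 16 * inner ℝ w qPt + ‖qPt‖ ^ 2 * ‖w‖ ^ 2 := by
  have hcs : inner ℝ w qPt ≤ ‖w‖ * ‖qPt‖ := real_inner_le_norm _ _
  rw [norm_qPt] at hcs ⊢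
  nlinarith [norm_nonneg w]

/-- **`farMob w = N (8 w/‖w‖²)` for `w ≠ 0`**: the closed form is the Möbius inversion of the
inverted point. [folklore] -/
theorem farMob_eq_mobN {w : EuclideanSpace ℝ (Fin 3)} (hw0 : w ≠ 0) (hw : ‖w‖ < 16 / 3) :
    farMob w = mobN ((8 / ‖w‖ ^ 2) • w) := by
  have hwn : 0 < ‖w‖ := norm_pos_iff.2 hw0
  have hw2 : ‖w‖ ^ 2 ≠ 0 := by positivity
  have hden := farDen_pos hw
  -- `‖8 w/‖w‖² - q‖² = (64 - 16 ⟪w, q⟫ + ‖q‖² ‖w‖²)/‖w‖²`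
  have hnorm : ‖(8 / ‖w‖ ^ 2) • w - qPt‖ ^ 2 = (64 - 16 * inner ℝ w qPt + ‖qPt‖ ^ 2 * ‖w‖ ^ 2) / ‖w‖ ^ 2 := by
    rw [@norm_sub_sq_real, norm_smul, inner_smul_left, Real.norm_of_nonneg (by positivity)]
    simp only [RCLike.conj_to_real]
    field_simp
    ring
  rw [mobN, hnorm, farMob, inv_div, smul_sub, smul_sub, smul_smul, smul_smul, smul_smul]
  congr 1
  · congr 1; field_simp
  · congr 1; rw [div_eq_inv_mul]

/-- `farMob 0 = 0`. [folklore] -/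
@[simp] theorem farMob_zero : farMob 0 = 0 := by simp [farMob]

/-- `farMob` is smooth on `B(0, 16/3)`. [folklore] -/
theorem contDiffAt_farMob {w : EuclideanSpace ℝ (Fin 3)} (hw : ‖w‖ < 16 / 3) : ContDiffAt ℝ ∞ farMob w := by
  have h1 : ContDiff ℝ ∞ fun w : EuclideanSpace ℝ (Fin 3) => 64 - 16 * inner ℝ w qPt + ‖qPt‖ ^ 2 * ‖w‖ ^ 2 :=
    (contDiff_const.sub (contDiff_const.mul (contDiff_id.inner ℝ contDiff_const))).add
      (contDiff_const.mul (contDiff_norm_sq ℝ))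
  have h2 : ContDiff ℝ ∞ fun w : EuclideanSpace ℝ (Fin 3) => (8 : ℝ) • w - ‖w‖ ^ 2 • qPt :=
    (contDiff_const_smul (8 : ℝ)).sub ((contDiff_norm_sq ℝ).smul contDiff_const)
  exact (h1.contDiffAt.inv (farDen_pos hw).ne').smul h2.contDiffAt

/-- `‖farMob w‖ < 2` on `B(0, 4)`: the far disc lands in the ball of radius `2` of the blown-up
coordinates. [folklore] -/
theorem norm_farMob_lt {w : EuclideanSpace ℝ (Fin 3)} (hw : ‖w‖ < 4) : ‖farMob w‖ < 2 := by
  rcases eq_or_ne w 0 with rfl | hw0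
  · simp
  · have hwn : 0 < ‖w‖ := norm_pos_iff.2 hw0
    rw [farMob_eq_mobN hw0 (by linarith), norm_mobN]
    have hv : ‖(8 / ‖w‖ ^ 2) • w‖ = 8 / ‖w‖ := by
      rw [norm_smul, Real.norm_of_nonneg (by positivity)]; field_simp
    have h2 : 2 < 8 / ‖w‖ := by rw [lt_div_iff₀ hwn]; linarith
    have hsub : 1 / 2 < ‖(8 / ‖w‖ ^ 2) • w - qPt‖ := by
      have := norm_sub_norm_le ((8 / ‖w‖ ^ 2) • w) qPt
      rw [hv, norm_qPt] at this
      linarith [abs_le.1 (abs_norm_sub_norm_le ((8 / ‖w‖ ^ 2) • w) qPt)]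
    rw [inv_lt_comm₀ (by linarith) (by norm_num)]
    linarith

/-- `farMob` is injective on `B(0, 4)`. [folklore] -/
theorem farMob_injOn : InjOn farMob (ball 0 4) := by
  intro w hw w' hw' h
  rw [mem_ball_zero_iff] at hw hw'
  -- the inverted points are at distance `> 2` from the origin, hence off `q`
  have key : ∀ {v : EuclideanSpace ℝ (Fin 3)}, v ≠ 0 → ‖v‖ < 4 → (8 / ‖v‖ ^ 2) • v ≠ qPt := by
    intro v hv0 hv h0
    have := congrArg norm h0
    rw [norm_smul, Real.norm_of_nonneg (by positivity), norm_qPt] at this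
    have hvn : 0 < ‖v‖ := norm_pos_iff.2 hv0
    field_simp at this
    nlinarith
  rcases eq_or_ne w 0 with rfl | hw0 <;> rcases eq_or_ne w' 0 with rfl | hw0'
  · rfl
  · exfalso
    rw [farMob_zero, farMob_eq_mobN hw0' (by linarith)] at h
    exact mobN_ne_zero (key hw0' hw') h.symm
  · exfalso
    rw [farMob_zero, farMob_eq_mobN hw0 (by linarith)] at h
    exact mobN_ne_zero (key hw0 hw) h
  · rw [farMob_eq_mobN hw0 (by linarith), farMob_eq_mobN hw0' (by linarith)] at h
    have h1 : (8 / ‖w‖ ^ 2) • w = (8 / ‖w'‖ ^ 2) • w' := by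
      rw [← mobM_mobN (key hw0 hw), h, mobM_mobN (key hw0' hw')]
    -- invert the inversion: apply it once more
    have hinv : ∀ {v : EuclideanSpace ℝ (Fin 3)}, v ≠ 0 → (8 / ‖(8 / ‖v‖ ^ 2) • v‖ ^ 2) • ((8 / ‖v‖ ^ 2) • v) = v := by
      intro v hv0
      have hvn : 0 < ‖v‖ := norm_pos_iff.2 hv0
      rw [norm_smul, Real.norm_of_nonneg (by positivity), smul_smul]
      have : 8 / (8 / ‖v‖ ^ 2 * ‖v‖) ^ 2 * (8 / ‖v‖ ^ 2) = 1 := by field_simp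
      rw [this, one_smul]
    rw [← hinv hw0, h1, hinv hw0']

/-! ### §E Smooth embeddings of `ℝ³` from left inverses; the standard discs -/

section EmbeddingCriterion

variable {F : Type*} [NormedAddCommGroup F] [NormedSpace ℝ F]

/-- **A local left inverse differentiable at the image point forces an injective derivative**
(chain rule: `Dg ∘ Df = id`). [folklore] -/
theorem injective_fderiv_of_eventually_leftInverse {f : EuclideanSpace ℝ (Fin 3) → F} {g : F → EuclideanSpace ℝ (Fin 3)}
    {x : EuclideanSpace ℝ (Fin 3)} (hf : DifferentiableAt ℝ f x) (hg : DifferentiableAt ℝ g (f x))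
    (h : ∀ᶠ y in 𝓝 x, g (f y) = y) : Injective (fderiv ℝ f x) := by
  have hcomp : fderiv ℝ (g ∘ f) x = (fderiv ℝ g (f x)).comp (fderiv ℝ f x) := fderiv_comp x hg hf
  have hid : fderiv ℝ (g ∘ f) x = ContinuousLinearMap.id ℝ _ := by
    rw [Filter.EventuallyEq.fderiv_eq (show g ∘ f =ᶠ[𝓝 x] id from h), fderiv_id]
  intro v w hvw
  have := congrArg (fderiv ℝ (g ∘ f) x) (show v = v from rfl)
  have h1 : fderiv ℝ (g ∘ f) x v = fderiv ℝ (g ∘ f) x w := by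
    rw [hcomp, ContinuousLinearMap.comp_apply, ContinuousLinearMap.comp_apply, hvw]
  rwa [hid, ContinuousLinearMap.id_apply, ContinuousLinearMap.id_apply] at h1

end EmbeddingCriterion

/-- **An injective smooth map `ℝ³ → ℝ³` with everywhere injective derivative is a smooth
embedding with open range** (immersion by `isImmersion_of_injective_mfderiv`, local
diffeomorphism by the dimension count, hence an open map; Lee 2013, Prop. 4.22, 5.2).
[cite: LeeSmoothManifolds2013, Prop. 5.2] -/
theorem isSmoothEmbedding_of_injective_of_injective_fderiv {f : EuclideanSpace ℝ (Fin 3) → EuclideanSpace ℝ (Fin 3)}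
    (hf : ContDiff ℝ ∞ f) (hinj : Injective f) (hd : ∀ x, Injective (fderiv ℝ f x)) :
    Manifold.IsSmoothEmbedding 𝓘(ℝ, EuclideanSpace ℝ (Fin 3)) 𝓘(ℝ, EuclideanSpace ℝ (Fin 3)) ∞ f ∧
      IsOpen (range f) := by
  have hfm : ContMDiff 𝓘(ℝ, EuclideanSpace ℝ (Fin 3)) 𝓘(ℝ, EuclideanSpace ℝ (Fin 3)) ∞ f := hf.contMDiff
  have hd' : ∀ x, Injective (mfderiv 𝓘(ℝ, EuclideanSpace ℝ (Fin 3)) 𝓘(ℝ, EuclideanSpace ℝ (Fin 3)) f x) := by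
    intro x; rw [mfderiv_eq_fderiv]; exact hd x
  have himm : Manifold.IsImmersion 𝓘(ℝ, EuclideanSpace ℝ (Fin 3)) 𝓘(ℝ, EuclideanSpace ℝ (Fin 3)) ∞ f :=
    isImmersion_of_injective_mfderiv hfm (by simp) hd'
  have hloc := himm.isLocalDiffeomorph_of_finrank_eq rfl
  have hopen : IsOpenMap f := hloc.isLocalHomeomorph.isOpenMap
  have hoe : Topology.IsOpenEmbedding f :=
    Topology.IsOpenEmbedding.of_continuous_injective_isOpenMap hf.continuous hinj hopen
  exact ⟨⟨himm, hoe.isEmbedding⟩, hoe.isOpen_range⟩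

/-- The derivative of the blow-down is everywhere injective (its local left inverse is the
blow-up). [folklore] -/
theorem injective_fderiv_blowDown (z : EuclideanSpace ℝ (Fin 3)) : Injective (fderiv ℝ blowDown z) := by
  have hz : ‖blowDown z‖ < 1 / 8 := norm_blowDown_lt z
  refine injective_fderiv_of_eventually_leftInverse (contDiff_blowDown.contDiffAt.differentiableAt (by simp))
    ((contDiffAt_blowUp hz).differentiableAt (by simp)) (Filter.Eventually.of_forall fun y => ?_)
  exact blowUp_blowDown y

/-- The derivative of the Möbius inversion is injective off `q`. [folklore] -/
theorem injective_fderiv_mobN {x : EuclideanSpace ℝ (Fin 3)} (hx : x ≠ qPt) : Injective (fderiv ℝ mobN x) := by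
  refine injective_fderiv_of_eventually_leftInverse ((contDiffAt_mobN hx).differentiableAt (by simp))
    ((contDiffAt_mobM (mobN_ne_zero hx)).differentiableAt (by simp)) ?_
  filter_upwards [isOpen_ne.mem_nhds hx] with y hy
  exact mobM_mobN hy

/-- The derivative of the ball contraction is everywhere injective. [folklore] -/
theorem injective_fderiv_ballContraction (w : EuclideanSpace ℝ (Fin 3)) :
    Injective (fderiv ℝ (ballContraction : EuclideanSpace ℝ (Fin 3) → EuclideanSpace ℝ (Fin 3)) w) := by
  refine injective_fderiv_of_eventually_leftInverse (contDiff_ballContraction.contDiffAt.differentiableAt (by simp))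
    ((contDiffAt_ballContractionInv (norm_ballContraction_lt_one w)).differentiableAt (by simp))
    (Filter.Eventually.of_forall fun y => ballContractionInv_ballContraction y)

/-- The derivative of `fourBall` is everywhere injective (local left inverse
`y ↦ g⁻¹(y/4)/8`). [folklore] -/
theorem injective_fderiv_fourBall (x : EuclideanSpace ℝ (Fin 3)) : Injective (fderiv ℝ fourBall x) := by
  have hlt : ‖(4 : ℝ)⁻¹ • fourBall x‖ < 1 := by
    rw [norm_smul, norm_inv, Real.norm_of_nonneg (by norm_num : (0:ℝ) ≤ 4)]
    linarith [norm_fourBall_lt x]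
  have hg : DifferentiableAt ℝ (fun y : EuclideanSpace ℝ (Fin 3) => (8 : ℝ)⁻¹ • ballContractionInv ((4 : ℝ)⁻¹ • y)) (fourBall x) := by
    refine (DifferentiableAt.comp (fourBall x) ?_ ((differentiableAt_id (𝕜 := ℝ)).const_smul ((4 : ℝ)⁻¹))).const_smul ((8 : ℝ)⁻¹)
    exact (contDiffAt_ballContractionInv hlt).differentiableAt (by simp)
  refine injective_fderiv_of_eventually_leftInverse (contDiff_fourBall.contDiffAt.differentiableAt (by simp)) hg
    (Filter.Eventually.of_forall fun y => ?_)
  show (8 : ℝ)⁻¹ • ballContractionInv ((4 : ℝ)⁻¹ • ((4 : ℝ) • ballContraction ((8 : ℝ) • y))) = y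
  rw [inv_smul_smul₀ (by norm_num : (4 : ℝ) ≠ 0), ballContractionInv_ballContraction, inv_smul_smul₀ (by norm_num : (8 : ℝ) ≠ 0)]

/-- `farMob` agrees near a nonzero point of `B(0, 4)` with `N ∘ inv₈`. [folklore] -/
theorem farMob_eventuallyEq {w : EuclideanSpace ℝ (Fin 3)} (hw0 : w ≠ 0) (hw : ‖w‖ < 16 / 3) :
    farMob =ᶠ[𝓝 w] fun w => mobN ((8 / ‖w‖ ^ 2) • w) := by
  filter_upwards [isOpen_ne.mem_nhds hw0, (isOpen_lt continuous_norm continuous_const).mem_nhds hw] with v hv hv'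
  exact farMob_eq_mobN hv hv'

/-- The inversion `w ↦ 8 w/‖w‖²` is an involution off `0`. [folklore] -/
theorem inv8_inv8 {v : EuclideanSpace ℝ (Fin 3)} (hv : v ≠ 0) :
    (8 / ‖(8 / ‖v‖ ^ 2) • v‖ ^ 2) • ((8 / ‖v‖ ^ 2) • v) = v := by
  have hvn : 0 < ‖v‖ := norm_pos_iff.2 hv
  rw [norm_smul, Real.norm_of_nonneg (by positivity), smul_smul]
  have : 8 / (8 / ‖v‖ ^ 2 * ‖v‖) ^ 2 * (8 / ‖v‖ ^ 2) = 1 := by field_simp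
  rw [this, one_smul]

/-- The inversion `w ↦ 8 w/‖w‖²` is smooth off `0`. [folklore] -/
theorem contDiffAt_inv8 {v : EuclideanSpace ℝ (Fin 3)} (hv : v ≠ 0) :
    ContDiffAt ℝ ∞ (fun w : EuclideanSpace ℝ (Fin 3) => (8 / ‖w‖ ^ 2) • w) v :=
  (contDiffAt_const.div (contDiff_norm_sq ℝ).contDiffAt (pow_ne_zero 2 (norm_ne_zero_iff.2 hv))).smul contDiffAt_id

/-- The derivative of `farMob` at `0` is `8⁻¹ • id`. [folklore] -/
theorem hasFDerivAt_farMob_zero :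
    HasFDerivAt farMob ((64 : ℝ)⁻¹ • ((8 : ℝ) • ContinuousLinearMap.id ℝ (EuclideanSpace ℝ (Fin 3)))) 0 := by
  set c : EuclideanSpace ℝ (Fin 3) → ℝ := fun w => (64 - 16 * inner ℝ w qPt + ‖qPt‖ ^ 2 * ‖w‖ ^ 2)⁻¹ with hc_def
  set v : EuclideanSpace ℝ (Fin 3) → EuclideanSpace ℝ (Fin 3) := fun w => (8 : ℝ) • w - ‖w‖ ^ 2 • qPt with hv_def
  have hfar : farMob = fun w => c w • v w := rfl
  have hn2 : DifferentiableAt ℝ (fun w : EuclideanSpace ℝ (Fin 3) => ‖w‖ ^ 2) 0 :=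
    (contDiff_norm_sq ℝ (n := 1)).contDiffAt.differentiableAt one_ne_zero
  have hc : DifferentiableAt ℝ c 0 := by
    refine DifferentiableAt.inv ?_ (by simp)
    exact ((differentiableAt_const _).sub ((differentiableAt_const _).mul
      ((differentiableAt_id).inner ℝ (differentiableAt_const _)))).add ((differentiableAt_const _).mul hn2)
  have hv : HasFDerivAt v ((8 : ℝ) • ContinuousLinearMap.id ℝ _) 0 := by
    have h1 : HasFDerivAt (fun w : EuclideanSpace ℝ (Fin 3) => (8 : ℝ) • w) ((8 : ℝ) • ContinuousLinearMap.id ℝ _) 0 := by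
      have := (hasFDerivAt_id (𝕜 := ℝ) (0 : EuclideanSpace ℝ (Fin 3))).const_smul (8 : ℝ)
      simpa only [Pi.smul_def, id] using this
    have h3 : HasFDerivAt (fun w : EuclideanSpace ℝ (Fin 3) => ‖w‖ ^ 2) (0 : EuclideanSpace ℝ (Fin 3) →L[ℝ] ℝ) 0 := by
      simpa using (hasStrictFDerivAt_norm_sq (0 : EuclideanSpace ℝ (Fin 3))).hasFDerivAt
    have h2 : HasFDerivAt (fun w : EuclideanSpace ℝ (Fin 3) => ‖w‖ ^ 2 • qPt)
        ((0 : EuclideanSpace ℝ (Fin 3) →L[ℝ] ℝ).smulRight qPt) 0 := h3.smul_const qPt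
    have h4 := h1.sub h2
    have hLeq : ((8 : ℝ) • ContinuousLinearMap.id ℝ (EuclideanSpace ℝ (Fin 3)) -
        (0 : EuclideanSpace ℝ (Fin 3) →L[ℝ] ℝ).smulRight qPt) = (8 : ℝ) • ContinuousLinearMap.id ℝ _ := by
      ext1 u; simp
    rw [hLeq] at h4
    refine h4.congr_of_eventuallyEq (Filter.Eventually.of_forall fun w => ?_)
    simp [hv_def]
  have key : HasFDerivAt (fun w => c w • v w) (c 0 • ((8 : ℝ) • ContinuousLinearMap.id ℝ _) + (fderiv ℝ c 0).smulRight (v 0)) 0 :=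
    hc.hasFDerivAt.smul hv
  have hv0 : v 0 = 0 := by simp [hv_def]
  have hc0 : c 0 = (64 : ℝ)⁻¹ := by simp [hc_def]
  have hzero : (fderiv ℝ c 0).smulRight (v 0) = 0 := by
    rw [hv0]; ext1 u; simp
  rw [hzero, add_zero, hc0] at key
  rw [hfar]
  exact key

/-- The derivative of `farMob` is injective on `B(0, 4)`. [folklore] -/
theorem injective_fderiv_farMob {w : EuclideanSpace ℝ (Fin 3)} (hw : ‖w‖ < 4) : Injective (fderiv ℝ farMob w) := by
  rcases eq_or_ne w 0 with rfl | hw0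
  · rw [hasFDerivAt_farMob_zero.fderiv]
    intro v v' h
    simp only [FunLike.coe_smul, Pi.smul_apply, ContinuousLinearMap.id_apply, smul_smul] at h
    exact smul_right_injective _ (by norm_num : (64 : ℝ)⁻¹ * 8 ≠ 0) h
  · have hw' : ‖w‖ < 16 / 3 := by linarith
    rw [(farMob_eventuallyEq hw0 hw').fderiv_eq]
    have hv : (8 / ‖w‖ ^ 2) • w ≠ qPt := by
      intro h0
      have := congrArg norm h0
      rw [norm_smul, Real.norm_of_nonneg (by positivity), norm_qPt] at this
      have hwn : 0 < ‖w‖ := norm_pos_iff.2 hw0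
      field_simp at this
      nlinarith
    have hdiff_inv : DifferentiableAt ℝ (fun w : EuclideanSpace ℝ (Fin 3) => (8 / ‖w‖ ^ 2) • w) w :=
      (contDiffAt_inv8 hw0).differentiableAt (by simp)
    have hdiff_N : DifferentiableAt ℝ mobN ((8 / ‖w‖ ^ 2) • w) := (contDiffAt_mobN hv).differentiableAt (by simp)
    have hcomp : fderiv ℝ (fun v : EuclideanSpace ℝ (Fin 3) => mobN ((8 / ‖v‖ ^ 2) • v)) w =
        (fderiv ℝ mobN ((8 / ‖w‖ ^ 2) • w)).comp (fderiv ℝ (fun v : EuclideanSpace ℝ (Fin 3) => (8 / ‖v‖ ^ 2) • v) w) :=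
      fderiv_comp w (g := mobN) (f := fun v : EuclideanSpace ℝ (Fin 3) => (8 / ‖v‖ ^ 2) • v) hdiff_N hdiff_inv
    rw [hcomp]
    refine (injective_fderiv_mobN hv).comp ?_
    -- the inversion is its own local left inverse
    have hv0 : (8 / ‖w‖ ^ 2) • w ≠ 0 := smul_ne_zero (by positivity) hw0
    refine injective_fderiv_of_eventually_leftInverse hdiff_inv ((contDiffAt_inv8 hv0).differentiableAt (by simp)) ?_
    filter_upwards [isOpen_ne.mem_nhds hw0] with v hv
    exact inv8_inv8 hv

/-- `discNear` on the closed unit ball: `β̂⁻¹ (N (x/4))`. [folklore] -/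
theorem discNear_of_norm_le {x : EuclideanSpace ℝ (Fin 3)} (hx : ‖x‖ ≤ 1) :
    discNear x = blowDown (mobN ((4 : ℝ)⁻¹ • x)) := by
  rw [discNear, fourBall_eq_self hx]

/-- `discFar` on the closed unit ball: `β̂⁻¹ (farMob x)`. [folklore] -/
theorem discFar_of_norm_le {x : EuclideanSpace ℝ (Fin 3)} (hx : ‖x‖ ≤ 1) : discFar x = blowDown (farMob x) := by
  rw [discFar, fourBall_eq_self hx]

/-- `discNear 0` is the near centre `β̂⁻¹ (N 0)`. [folklore] -/
@[simp] theorem discNear_zero : discNear 0 = nearCentre := by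
  rw [discNear_of_norm_le (by simp), smul_zero]; rfl

/-- `discFar 0 = 0`. [folklore] -/
@[simp] theorem discFar_zero : discFar 0 = 0 := by
  rw [discFar_of_norm_le (by simp), farMob_zero, blowDown_zero]

/-- The argument of `N` in `discNear` has norm `< 1`, hence is not `q`. [folklore] -/
theorem norm_quarter_fourBall_lt (x : EuclideanSpace ℝ (Fin 3)) : ‖(4 : ℝ)⁻¹ • fourBall x‖ < 1 := by
  rw [norm_smul, norm_inv, Real.norm_of_nonneg (by norm_num : (0:ℝ) ≤ 4)]
  linarith [norm_fourBall_lt x]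

/-- The argument of `N` in `discNear` is not `q`. [folklore] -/
theorem quarter_fourBall_ne_qPt (x : EuclideanSpace ℝ (Fin 3)) : (4 : ℝ)⁻¹ • fourBall x ≠ qPt := fun h => by
  have := norm_quarter_fourBall_lt x
  rw [h, norm_qPt] at this
  norm_num at this

/-- `discNear` is smooth. [folklore] -/
theorem contDiff_discNear : ContDiff ℝ ∞ discNear := by
  rw [contDiff_iff_contDiffAt]
  intro x
  have h1 : ContDiffAt ℝ ∞ (fun x : EuclideanSpace ℝ (Fin 3) => (4 : ℝ)⁻¹ • fourBall x) x :=
    (contDiff_fourBall.const_smul _).contDiffAt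
  have h2 : ContDiffAt ℝ ∞ (mobN ∘ fun x : EuclideanSpace ℝ (Fin 3) => (4 : ℝ)⁻¹ • fourBall x) x :=
    (contDiffAt_mobN (quarter_fourBall_ne_qPt x)).comp x h1
  have h3 : discNear = blowDown ∘ (mobN ∘ fun x : EuclideanSpace ℝ (Fin 3) => (4 : ℝ)⁻¹ • fourBall x) := rfl
  rw [h3]
  exact contDiff_blowDown.contDiffAt.comp x h2

/-- `discFar` is smooth. [folklore] -/
theorem contDiff_discFar : ContDiff ℝ ∞ discFar := by
  rw [contDiff_iff_contDiffAt]
  intro x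
  have h2 : ContDiffAt ℝ ∞ (farMob ∘ fourBall) x :=
    (contDiffAt_farMob (by linarith [norm_fourBall_lt x])).comp x contDiff_fourBall.contDiffAt
  have h3 : discFar = blowDown ∘ (farMob ∘ fourBall) := rfl
  rw [h3]
  exact contDiff_blowDown.contDiffAt.comp x h2

/-- `‖N (x/4)‖ < 2` for the arguments occurring in `discNear`. [folklore] -/
theorem norm_mobN_quarter_lt (x : EuclideanSpace ℝ (Fin 3)) : ‖mobN ((4 : ℝ)⁻¹ • fourBall x)‖ < 2 := by
  rw [norm_mobN]
  have h1 : 1 / 2 < ‖(4 : ℝ)⁻¹ • fourBall x - qPt‖ := by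
    have := norm_sub_norm_le qPt ((4 : ℝ)⁻¹ • fourBall x)
    rw [norm_qPt, norm_sub_rev] at this
    linarith [norm_quarter_fourBall_lt x]
  rw [inv_lt_comm₀ (by linarith) (by norm_num)]
  linarith

/-- `b̂⁻¹` is strictly increasing on `[0, ∞)`. [folklore] -/
theorem blowProfileInv_lt_iff {r r' : ℝ} (hr : 0 ≤ r) (hr' : 0 ≤ r') : blowProfileInv r < blowProfileInv r' ↔ r < r' := by
  obtain ⟨hm, he⟩ := blowProfileInv_spec hr
  obtain ⟨hm', he'⟩ := blowProfileInv_spec hr'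
  rw [← strictMonoOn_blowProfile.lt_iff_lt hm.2 hm'.2, he, he']

/-- `‖β̂⁻¹ z‖ < 1/12` iff `‖z‖ < 2`. [folklore] -/
theorem norm_blowDown_lt_iff {z : EuclideanSpace ℝ (Fin 3)} : ‖blowDown z‖ < 1 / 12 ↔ ‖z‖ < 2 := by
  have h2 : blowProfileInv 2 = 1 / 12 := by rw [blowProfileInv_of_ge (by norm_num)]; norm_num
  rw [norm_blowDown, ← h2, blowProfileInv_lt_iff (norm_nonneg _) (by norm_num)]

/-- The near disc lies in the ball of radius `1/12` of the chart. [folklore] -/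
theorem norm_discNear_lt (x : EuclideanSpace ℝ (Fin 3)) : ‖discNear x‖ < 1 / 12 := by
  rw [discNear, norm_blowDown_lt_iff]; exact norm_mobN_quarter_lt x

/-- The far disc lies in the ball of radius `1/12` of the chart. [folklore] -/
theorem norm_discFar_lt (x : EuclideanSpace ℝ (Fin 3)) : ‖discFar x‖ < 1 / 12 := by
  rw [discFar, norm_blowDown_lt_iff]; exact norm_farMob_lt (norm_fourBall_lt x)

/-- `discNear` is injective. [folklore] -/
theorem discNear_injective : Injective discNear := fun x x' h => by
  have h1 := blowDown_injective h
  have h2 : (4 : ℝ)⁻¹ • fourBall x = (4 : ℝ)⁻¹ • fourBall x' := by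
    rw [← mobM_mobN (quarter_fourBall_ne_qPt x), h1, mobM_mobN (quarter_fourBall_ne_qPt x')]
  exact fourBall_injective (smul_right_injective _ (by norm_num) h2)

/-- `discFar` is injective. [folklore] -/
theorem discFar_injective : Injective discFar := fun x x' h =>
  fourBall_injective (farMob_injOn (mem_ball_zero_iff.2 (norm_fourBall_lt x))
    (mem_ball_zero_iff.2 (norm_fourBall_lt x')) (blowDown_injective h))

/-- **The two standard discs are disjoint** (the near one blows up into `N(B(0, 1))`, the far one
into `N({‖·‖ > 2} ∪ ∞)`). [folklore] -/
theorem disjoint_range_discNear_discFar : Disjoint (range discNear) (range discFar) := by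
  refine disjoint_left.2 ?_
  rintro _ ⟨x, rfl⟩ ⟨x', h⟩
  have h1 : farMob (fourBall x') = mobN ((4 : ℝ)⁻¹ • fourBall x) := blowDown_injective h
  rcases eq_or_ne (fourBall x') 0 with h0 | h0
  · rw [h0, farMob_zero] at h1
    exact mobN_ne_zero (quarter_fourBall_ne_qPt x) h1.symm
  · rw [farMob_eq_mobN h0 (by linarith [norm_fourBall_lt x'])] at h1
    have hv : (8 / ‖fourBall x'‖ ^ 2) • fourBall x' ≠ qPt := by
      intro h2
      have := congrArg norm h2
      rw [norm_smul, Real.norm_of_nonneg (by positivity), norm_qPt] at this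
      have hwn : 0 < ‖fourBall x'‖ := norm_pos_iff.2 h0
      field_simp at this
      nlinarith [norm_fourBall_lt x']
    have h3 := congrArg norm ((mobM_mobN hv).symm.trans ((congrArg mobM h1).trans (mobM_mobN (quarter_fourBall_ne_qPt x))))
    rw [norm_smul, Real.norm_of_nonneg (by positivity)] at h3
    have hwn : 0 < ‖fourBall x'‖ := norm_pos_iff.2 h0
    have h4 : 8 / ‖fourBall x'‖ ^ 2 * ‖fourBall x'‖ = 8 / ‖fourBall x'‖ := by field_simp
    rw [h4] at h3
    have h5 : 2 < 8 / ‖fourBall x'‖ := by rw [lt_div_iff₀ hwn]; linarith [norm_fourBall_lt x']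
    linarith [norm_quarter_fourBall_lt x]

/-- **`discNear` is a smooth embedding of `ℝ³`** (with open range). [cite: Kosinski1993, VI §9] -/
theorem isSmoothEmbedding_discNear :
    Manifold.IsSmoothEmbedding 𝓘(ℝ, EuclideanSpace ℝ (Fin 3)) 𝓘(ℝ, EuclideanSpace ℝ (Fin 3)) ∞ discNear ∧
      IsOpen (range discNear) := by
  refine isSmoothEmbedding_of_injective_of_injective_fderiv contDiff_discNear discNear_injective fun x => ?_
  have h1 : DifferentiableAt ℝ (fun x : EuclideanSpace ℝ (Fin 3) => (4 : ℝ)⁻¹ • fourBall x) x :=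
    ((contDiff_fourBall.const_smul _).differentiable (by simp)).differentiableAt
  have hN : DifferentiableAt ℝ mobN ((4 : ℝ)⁻¹ • fourBall x) :=
    (contDiffAt_mobN (quarter_fourBall_ne_qPt x)).differentiableAt (by simp)
  have hB : DifferentiableAt ℝ blowDown (mobN ((4 : ℝ)⁻¹ • fourBall x)) := contDiff_blowDown.contDiffAt.differentiableAt (by simp)
  rw [show discNear = blowDown ∘ (mobN ∘ fun x : EuclideanSpace ℝ (Fin 3) => (4 : ℝ)⁻¹ • fourBall x) from rfl,
    fderiv_comp x hB (hN.comp x h1), fderiv_comp x hN h1]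
  refine (injective_fderiv_blowDown _).comp ((injective_fderiv_mobN (quarter_fourBall_ne_qPt x)).comp ?_)
  show Injective (fderiv ℝ ((4 : ℝ)⁻¹ • fourBall) x)
  rw [((contDiff_fourBall.contDiffAt.differentiableAt (by simp)).hasFDerivAt.const_smul (4 : ℝ)⁻¹).fderiv]
  intro v w hvw
  simp only [FunLike.coe_smul, Pi.smul_apply] at hvw
  exact injective_fderiv_fourBall x (smul_right_injective _ (by norm_num) hvw)

/-- **`discFar` is a smooth embedding of `ℝ³`** (with open range). [cite: Kosinski1993, VI §9] -/
theorem isSmoothEmbedding_discFar :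
    Manifold.IsSmoothEmbedding 𝓘(ℝ, EuclideanSpace ℝ (Fin 3)) 𝓘(ℝ, EuclideanSpace ℝ (Fin 3)) ∞ discFar ∧
      IsOpen (range discFar) := by
  refine isSmoothEmbedding_of_injective_of_injective_fderiv contDiff_discFar discFar_injective fun x => ?_
  have h1 : DifferentiableAt ℝ fourBall x := contDiff_fourBall.contDiffAt.differentiableAt (by simp)
  have hF : DifferentiableAt ℝ farMob (fourBall x) :=
    (contDiffAt_farMob (by linarith [norm_fourBall_lt x])).differentiableAt (by simp)
  have hB : DifferentiableAt ℝ blowDown (farMob (fourBall x)) := contDiff_blowDown.contDiffAt.differentiableAt (by simp)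
  rw [show discFar = blowDown ∘ (farMob ∘ fourBall) from rfl, fderiv_comp x hB (hF.comp x h1), fderiv_comp x hF h1]
  exact (injective_fderiv_blowDown _).comp ((injective_fderiv_farMob (norm_fourBall_lt x)).comp (injective_fderiv_fourBall x))

end ZeroSphereModel

end Literature.Topology.FourManifolds
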